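import Summits.Langlands.Langlands.Theorems.LevelOneDyadicTower

/-!
# decomp-langlands · lens 4 (minimal counterexample / extremal reduction) · generation 14 · NODE `InsolubleResidueReduction`

TREE TWIN (census-1 g17, lens RUNME §3 (M) «LevelOneDyadic part 10»): this file = `HOME/nodes/lens-4-g14-InsolubleResidueReduction.lean`
(sha256 804afc986510…, 371 lines) verbatim, plus three one-line docstrings on `dial_disjoint₁₂/₂₃/₁₃` (doc lint); statements byte-identical to the node
and to the child-route kit `…childroute.route.json` items (AB / SOL / INS / FRAME).


TARGET (RESIDUAL MODE, blocker first).  B₂ = `MinimalLevelDescent.DyadicLevelOneAutomorphy` (stmt-Langlands-27523): crux r2 — the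
HARDEST-ranked and never-split crux of the lens-4 root route-Langlands-MinimalLevelDescent rev 3, the NORMAL-FORM BASE of the
Khare–Wintenberger height descent: every irreducible pinned-geometric 2-adic ρ : Γ_K → GL_n(ℚ̄₂) unramified away from 2 is
RESIDUALLY automorphic (an L-algebraic cuspidal π whose Satake polynomials are ≡ mod 𝔪(ℤ̄₂) to the Frobenius polynomials of ρ).
(The D-branch of the route is decomposed down to PR′ = PrimitiveCompanionReduction.PrimitiveCompanionCore, born 2026-08-30T17:28Z;
rule of record CRITIC-LEDGER row 163 forbids a further WLOG layer there without two OPEN strictly-weaker pieces — B₂ has them.)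

LENS-4 CONSTRUCTION — minimal counterexample ⇒ normal form.  B₂'s CONCLUSION is itself residual, so it sees ρ only through its
semisimple residual representation τ = ρ̄^ss : Γ_K → GL_n(ℤ̄₂/𝔪) (tree vocabulary `FramedGaloisRep.IsResidualRepOf`, Literature
`ResidualGaloisRep`): KERNEL III below (`isResiduallyAutomorphic_of_sharedResidual`, PROVED) — two 2-adic representations with a
common residual representation are residually automorphic together.  The dial is therefore the SOLUBILITY TYPE of im τ ⊂ GL_n(𝔽̄₂):

  B₂ ⟺ AB ∧ SOL ∧ INS   (KERNEL I `dyadicLevelOneAutomorphy_iff_cells`, exact by two excluded middles; every cell = B₂'s text + one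
                          hypothesis on τ, hence S-implied: `…_of_langlands` through the landed `LevelOneDyadic.residualAutomorphy_of_langlands`)

* AB  `AbelianResidueAutomorphy`   — im τ ABELIAN (τ a sum of odd-order characters unramified outside 2: the EISENSTEIN RESIDUE).
      WEAKER · OPEN · ATTACKABLE-NOW.  By KERNEL III it REDUCES (theorem `abelianResidueAutomorphy_of_line`) to the Teichmüller lift
      (`stub_teichmullerLift`, folklore) ∧ EISENSTEIN CUSPIDALISATION mod 2 (`stub_eisensteinCuspidalisation`: every finite-abelian-image
      level-one Artin representation is congruent mod 2 to a CUSPIDAL L-algebraic π — Ribet 1976 / Mazur 1977 / Mazur–Wiles / Skinner–Wiles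
      Eisenstein congruences; PRINT for (ℚ, every n): the only odd-order characters of Γ_ℚ of 2-power conductor are trivial and
      Sym^(n−1)Δ (Newton–Thorne 2021) has Satake polynomials ≡ (X−1)^n mod 2 since τ(p) is even; PRINT for n = 2, τ = 𝟙 ⊕ 𝟙 over EVERY K:
      AI_L^K of an order-4 ray-class character ψ ≠ ψ^σ of a quadratic L/K — quadratic and 2-power-order characters DIE mod 2).
* SOL `SolubleResidueAutomorphy`   — im τ SOLUBLE, non-abelian.  WEAKER · OPEN · ATTACKABLE-NOW.  By FONG–SWAN (Fong 1961, Swan 1963;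
      Serre, *Linear representations* §16–17, Thm 40: every 𝔽̄_p-representation of a p-soluble group lifts to characteristic 0) τ is
      the reduction of a finite-SOLUBLE-image Artin representation ρ₀ : Γ_K → GL_n(ℤ̄₂) unramified outside 2 (`stub_fongSwanLift`), and by
      KERNEL III the cell REDUCES (theorem `solubleResidueAutomorphy_of_line`) to `stub_solubleArtinResidualAutomorphy` = residual automorphy
      mod 2 of soluble Artin representations — SOLVABLE STRONG ARTIN (Langlands–Tunnell in rank 2, Arthur–Clozel for nilpotent image)
      + cuspidalisation; in CHARACTERISTIC 0.  PRINT for n = 2 over every K: a soluble irreducible subgroup of GL₂(𝔽̄₂) is DIHEDRAL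
      (normaliser of a torus; SL₂(𝔽₂) ≅ S₃ dihedral, SL₂(𝔽_(2^k)) insoluble for k ≥ 2), so τ = Ind_L^K χ̄ and Hecke's θ-series
      AI_L^K(teich χ̄) is the congruent cuspidal π (Hecke 1926/Jacquet–Langlands 1970 §12).
* INS `InsolubleResidueAutomorphy` — every residual representation of ρ has INSOLUBLE image: THE NORMAL FORM OF A MINIMAL COUNTEREXAMPLE
      TO B₂.  WEAKER · OPEN · DECLARED RESIDUAL · INSTRUMENTABLE: the census certifies, field-theoretically, that NO insoluble
      G ⊂ GL_n(𝔽̄₂) occurs as a Galois image unramified outside {2, ∞} for small (K, n) — (ℚ, 2): Tate 1994 (void); (ℚ, 3): the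
      insoluble irreducible subgroups of GL₃(𝔽̄₂) have simple socle PSL₂(7), A₅, A₆, PSL₃(2^j), PSU₃(2^j) (Hartley 1925), the first three
      are decided by the Jones–Roberts tables of septic/sextic/quintic fields of 2-power discriminant (none insoluble), the Lie-type ones
      by GRH-Odlyzko; the KNOWN inhabitants (Dembélé 2009: SL₂(𝔽_(2^8))-images over ℚ(ζ₃₂)⁺ of level one, hence over ℚ in rank 16 by
      cyclic automorphic induction; Dembélé–Greenberg–Voight 2011) are AUTOMORPHIC BY BIRTH — the structure a proof must explain: every
      insoluble level-one mod-2 Galois image found so far was found inside the cohomology of an arithmetic group.  Birth skeleton: rank ≤ 2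
      (Serre's conjecture mod 2 for SL₂(𝔽_(2^k))/icosahedral images over K — the Khare–Wintenberger–Kisin 2-adic sector over totally real K:
      ATTACKABLE) ∧ rank ≥ 3 (dark: no Serre-type conjecture mod 2 is a theorem for GL_n, n ≥ 3, over any K).

WHY EACH PIECE IS STRICTLY WEAKER THAN B₂ (and a fortiori than the summit): each cell is B₂ restricted to a residual-image class that
is non-empty over suitable (K, n) and none is known to give B₂: AB misses every ρ with irreducible τ (Dembélé's), SOL misses both the
Eisenstein residue and the insoluble one, INS misses the Eisenstein residue — where B₂ is the open Skinner–Wiles/Eisenstein-congruence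
problem over general K (no theorem `INS → B₂`, `AB → B₂`, `SOL → B₂` exists in print or in the tree; probes C ↛ B₂, C ↛ Langlands by
`exact?`/`aesop` fail, kit file `.probes.lean`).  WHY NOVEL: the other live dials read the ℓ-ADIC ρ (Lie type / Cartan rank — lens 2;
CM layer — lens 3; twist-controlled grade — lens 1; solvably reducible / mated, solvable inducibility OVER SOLVABLE EXTENSIONS inside the
weakly-automorphic box — lenses 5, 6); this node reads the MOD-2 IMAGE in the one box of the forest whose conclusion is residual, where
the reading is DECISIVE (KERNEL III) and has characteristic-2-specific print closures (quadratic characters vanish mod 2; soluble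
irreducible = dihedral in GL₂(𝔽̄₂); Fong–Swan lifting for 2-soluble groups turns SOL into a characteristic-0 Artin statement).
ORBIT CLOSURE of the dial: im τ ↦ abelian/soluble/insoluble is invariant under ρ ↦ ρ ⊗ χ (χ a level-one 2-adic character: τ ↦ τ ⊗ χ̄,
χ̄ central), under ρ ↦ ρ^∨ and Frobenius twists, under GL_n(𝔽̄₂)-conjugation of τ (Brauer–Nesbitt: τ is unique up to conjugacy,
`IsResidualRepOf.unique`), and SOL/INS under restriction to any soluble L/K.  JUNK READING: INS is typed `∀ τ, IsResidualRepOf → ¬ soluble`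
(≡ ¬ SOL-hypothesis, `isResiduallyInsoluble_iff`), vacuously true only if ρ had no residual representation — which never happens (Γ_K
compact; in the tree: rank 2 and residually irreducible ρ, `ResidualGaloisRepProofs`); exactness does not depend on it.

KERNELS (0 sorry; axioms propext / Classical.choice / Quot.sound):
  I   `dyadicLevelOneAutomorphy_iff_cells : B₂ ↔ AB ∧ SOL ∧ INS`, `dyadic_of_cells`, `abelian_of_dyadic`, `soluble_of_dyadic`, `insoluble_of_dyadic`;
  II  necessity `dyadic_of_serre`, `dyadic_of_langlands`, `abelian_of_langlands`, `soluble_of_langlands`, `insoluble_of_langlands`, `frame_of_host`, `frame_of_langlands`;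
  III `isResiduallyAutomorphic_of_sharedResidual` (any prime ℓ): residual automorphy is an invariant of the residual representation;
  IV  the certified reductions `abelianResidueAutomorphy_of_line : TL → EC → AB`, `solubleResidueAutomorphy_of_line : FS → SA → SOL`,
      `insolubleResidueAutomorphy_of_ranks : INS≤2 → INS≥3 → INS` (the three BC3 birth skeletons' compositions, stubs as hypotheses);
  V   `closes (hAB hSOL hINS hD hL hW hP hA hR) : Langlands` = `MinimalLevelDescent.closes hD (dyadic_of_cells …) …` and the child-route
      form `closes_framed (hAB hSOL hINS) (hF : DyadicLevelOneFrame) : Langlands`.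
Vehicle: child route `InsolubleResidueReduction` `--refines MinimalLevelDescent:DyadicLevelOneAutomorphy` (items AB, SOL, INS (residual),
FRAME `DyadicLevelOneFrame := B₂ → Langlands` = the host route below B₂, Assembly); tree twin = LevelOneDyadic part 10
`Theorems/LevelOneDyadicResidue.lean` (this file verbatim).
-/

set_option linter.dupNamespace false

namespace Summit.Langlands.Langlands.Theorems.LevelOneDyadic.Residue

open scoped NumberField
open Filter IsDedekindDomain Polynomial
open Literature.NumberTheory.GaloisRepresentations Literature.NumberTheory.Automorphic
open Summit.Langlands.Langlands.Theses
open Summit.Langlands.Langlands.Theorems.LevelOneDyadic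

variable {K : Type} [Field K] [NumberField K] {ℓ : ℕ} [Fact ℓ.Prime] {n : ℕ}

/-! ## Vocabulary — the dial: the solubility type of the image of the semisimple residual representation τ of ρ -/

/-- ρ : Γ_K → GL_n(ℚ̄₂) is RESIDUALLY ABELIAN: some (semisimple) residual representation τ of ρ has commutative image
(τ = a sum of odd-order characters: the Eisenstein residue). [dial, ℓ = 2] -/
def IsResiduallyAbelian (ρ : FramedGaloisRep K (PadicAlgCl 2) n) : Prop := (∃ τ : Field.absoluteGaloisGroup K →* GL (Fin n) (Literature.NumberTheory.GaloisRepresentations.padicAlgClResidueField 2), ρ.IsResidualRepOf (RingHom.id (Literature.NumberTheory.GaloisRepresentations.padicAlgClResidueField 2)) τ ∧ ∀ g h : Field.absoluteGaloisGroup K, τ g * τ h = τ h * τ g)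

/-- ρ is RESIDUALLY SOLUBLE: some residual representation τ of ρ has soluble image im τ ⊂ GL_n(ℤ̄₂/𝔪). [dial, ℓ = 2] -/
def IsResiduallySoluble (ρ : FramedGaloisRep K (PadicAlgCl 2) n) : Prop := (∃ τ : Field.absoluteGaloisGroup K →* GL (Fin n) (Literature.NumberTheory.GaloisRepresentations.padicAlgClResidueField 2), ρ.IsResidualRepOf (RingHom.id (Literature.NumberTheory.GaloisRepresentations.padicAlgClResidueField 2)) τ ∧ IsSolvable τ.range)

/-- ρ is RESIDUALLY INSOLUBLE: every residual representation of ρ has insoluble image (≡ ¬ `IsResiduallySoluble`,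
`isResiduallyInsoluble_iff`; the normal form of a minimal counterexample to B₂). [dial, ℓ = 2] -/
def IsResiduallyInsoluble (ρ : FramedGaloisRep K (PadicAlgCl 2) n) : Prop := (∀ τ : Field.absoluteGaloisGroup K →* GL (Fin n) (Literature.NumberTheory.GaloisRepresentations.padicAlgClResidueField 2), ρ.IsResidualRepOf (RingHom.id (Literature.NumberTheory.GaloisRepresentations.padicAlgClResidueField 2)) τ → ¬ IsSolvable τ.range)

/-- Level one away from 2: unramified at every v ∤ 2 (B₂'s level hypothesis, verbatim). -/
def IsUnramifiedAwayFromTwo (ρ : FramedGaloisRep K (PadicAlgCl 2) n) : Prop := (∀ v : IsDedekindDomain.HeightOneSpectrum (NumberField.RingOfIntegers K), ((2 : ℕ) : NumberField.RingOfIntegers K) ∉ v.asIdeal → ρ.IsUnramifiedAt v)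

/-! ## The pieces (filed texts, verbatim = the child route's items) -/

/-- [crux AB · WEAKER(`abelian_of_dyadic`, `abelian_of_langlands`; no `AB → B₂`: probes) · OPEN · ATTACKABLE-NOW (Eisenstein
cuspidalisation mod 2: `abelianResidueAutomorphy_of_line`; PRINT cells (ℚ, n) via Sym^(n−1)Δ and (K, 2, τ = 𝟙⊕𝟙) via AI of an
order-4 character)] B₂ for ρ whose residual representation has ABELIAN image. -/
def AbelianResidueAutomorphy : Prop := ∀ (K : Type) [Field K] [NumberField K] (n : ℕ) (hcpt : Literature.NumberTheory.Automorphic.isCompact_glFiniteIntegralLevel n K), 0 < n → ∀ (ι : PadicAlgCl 2 ≃+* ℂ) (ρ : Literature.NumberTheory.GaloisRepresentations.FramedGaloisRep K (PadicAlgCl 2) n), ρ.toGaloisRep.IsIrreducible → (∃ τ : Field.absoluteGaloisGroup K →* GL (Fin n) (Literature.NumberTheory.GaloisRepresentations.padicAlgClResidueField 2), ρ.IsResidualRepOf (RingHom.id (Literature.NumberTheory.GaloisRepresentations.padicAlgClResidueField 2)) τ ∧ ∀ g h : Field.absoluteGaloisGroup K, τ g * τ h = τ h * τ g) → ((∀ᶠ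 v : IsDedekindDomain.HeightOneSpectrum (NumberField.RingOfIntegers K) in cofinite, ρ.IsUnramifiedAt v) ∧ ∀ (v : IsDedekindDomain.HeightOneSpectrum (NumberField.RingOfIntegers K)) (hv : ((2 : ℕ) : NumberField.RingOfIntegers K) ∈ v.asIdeal), (Literature.NumberTheory.PAdicHodge.fontainePstAdicCompletion v 2 hv).IsDeRhamFramed (ρ.toLocal v)) → (∀ v : IsDedekindDomain.HeightOneSpectrum (NumberField.RingOfIntegers K), ((2 : ℕ) : NumberField.RingOfIntegers K) ∉ v.asIdeal → ρ.IsUnramifiedAt v) → ∃ π : Literature.NumberTheory.Automorphic.CuspidalAutomorphicRepData n K hcpt, π.1.IsLAlgebraic ∧ ∀ᶠ v : IsDedekindDomain.HeightOneSpectrum (NumberField.RingOfIntegers K) in cofinite, ρ.IsUnramifiedAt v ∧ (∃ α : Multiset ℂ, π.1.HasSatakeParamAt v α) ∧ ∀ α : Multiset ℂ, π.1.HasSatakeParamAt v α → ∃ P Q : Polynomial (Valued.v : Valuation (PadicAlgCl 2) NNReal).valuationSubring, ρ.HasFrobCharpolyAt v (P.map (Valued.v : Valuation (PadicAlgCl 2)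 NNReal).valuationSubring.subtype) ∧ Literature.NumberTheory.Automorphic.arithFrobPolyOfSatake ι v.residueCard 1 α = Q.map (Valued.v : Valuation (PadicAlgCl 2) NNReal).valuationSubring.subtype ∧ P.map (IsLocalRing.residue (Valued.v : Valuation (PadicAlgCl 2) NNReal).valuationSubring) = Q.map (IsLocalRing.residue (Valued.v : Valuation (PadicAlgCl 2) NNReal).valuationSubring)

/-- [crux SOL · WEAKER(`soluble_of_dyadic`, `soluble_of_langlands`; no `SOL → B₂`) · OPEN · ATTACKABLE-NOW (Fong–Swan lift + solvable
strong Artin mod 2 in characteristic 0: `solubleResidueAutomorphy_of_line`; PRINT for n = 2 over every K: dihedral ⇒ Hecke θ-series)]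
B₂ for ρ whose residual representation has SOLUBLE NON-ABELIAN image. -/
def SolubleResidueAutomorphy : Prop := ∀ (K : Type) [Field K] [NumberField K] (n : ℕ) (hcpt : Literature.NumberTheory.Automorphic.isCompact_glFiniteIntegralLevel n K), 0 < n → ∀ (ι : PadicAlgCl 2 ≃+* ℂ) (ρ : Literature.NumberTheory.GaloisRepresentations.FramedGaloisRep K (PadicAlgCl 2) n), ρ.toGaloisRep.IsIrreducible → (∃ τ : Field.absoluteGaloisGroup K →* GL (Fin n) (Literature.NumberTheory.GaloisRepresentations.padicAlgClResidueField 2), ρ.IsResidualRepOf (RingHom.id (Literature.NumberTheory.GaloisRepresentations.padicAlgClResidueField 2)) τ ∧ IsSolvable τ.range) → ¬ (∃ τ : Field.absoluteGaloisGroup K →* GL (Fin n) (Literature.NumberTheory.GaloisRepresentations.padicAlgClResidueField 2), ρ.IsResidualRepOf (RingHom.id (Literature.NumberTheory.GaloisRepresentations.padicAlgClResidueField 2)) τ ∧ ∀ g h : Field.absoluteGaloisGroup K, τ g * τ h = τ h * τ g) → ((∀ᶠ v : IsDedekindDomain.HeightOneSpectrum (NumberField.RingOfIntegers K) in cofinite,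 ρ.IsUnramifiedAt v) ∧ ∀ (v : IsDedekindDomain.HeightOneSpectrum (NumberField.RingOfIntegers K)) (hv : ((2 : ℕ) : NumberField.RingOfIntegers K) ∈ v.asIdeal), (Literature.NumberTheory.PAdicHodge.fontainePstAdicCompletion v 2 hv).IsDeRhamFramed (ρ.toLocal v)) → (∀ v : IsDedekindDomain.HeightOneSpectrum (NumberField.RingOfIntegers K), ((2 : ℕ) : NumberField.RingOfIntegers K) ∉ v.asIdeal → ρ.IsUnramifiedAt v) → ∃ π : Literature.NumberTheory.Automorphic.CuspidalAutomorphicRepData n K hcpt, π.1.IsLAlgebraic ∧ ∀ᶠ v : IsDedekindDomain.HeightOneSpectrum (NumberField.RingOfIntegers K) in cofinite, ρ.IsUnramifiedAt v ∧ (∃ α : Multiset ℂ, π.1.HasSatakeParamAt v α) ∧ ∀ α : Multiset ℂ, π.1.HasSatakeParamAt v α → ∃ P Q : Polynomial (Valued.v : Valuation (PadicAlgCl 2) NNReal).valuationSubring, ρ.HasFrobCharpolyAt v (P.map (Valued.v : Valuation (PadicAlgCl 2) NNReal).valuationSubring.subtype) ∧ Literature.NumberTheory.Automorphic.arithFrobPolyOfSatake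 ι v.residueCard 1 α = Q.map (Valued.v : Valuation (PadicAlgCl 2) NNReal).valuationSubring.subtype ∧ P.map (IsLocalRing.residue (Valued.v : Valuation (PadicAlgCl 2) NNReal).valuationSubring) = Q.map (IsLocalRing.residue (Valued.v : Valuation (PadicAlgCl 2) NNReal).valuationSubring)

/-- [crux INS · DECLARED RESIDUAL · WEAKER(`insoluble_of_dyadic`, `insoluble_of_langlands`; no `INS → B₂`: the Eisenstein residue AB
is outside it and open) · OPEN · INSTRUMENTABLE (field-theoretic certification of the absence of insoluble level-one mod-2 images for
small (K, n): Tate (ℚ,2); Jones–Roberts 2-power-discriminant tables (ℚ,3) for PSL₂(7)/A₅/A₆ socles; GRH-Odlyzko for Lie type; known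
inhabitants (Dembélé 2009, DGV 2011) automorphic by birth) · birth skeleton INS≤2 (K–W–Kisin 2-adic sector, ATTACKABLE) ∧ INS≥3 (dark)]
B₂ for ρ all of whose residual representations have INSOLUBLE image — the normal form of a minimal counterexample to B₂. -/
def InsolubleResidueAutomorphy : Prop := ∀ (K : Type) [Field K] [NumberField K] (n : ℕ) (hcpt : Literature.NumberTheory.Automorphic.isCompact_glFiniteIntegralLevel n K), 0 < n → ∀ (ι : PadicAlgCl 2 ≃+* ℂ) (ρ : Literature.NumberTheory.GaloisRepresentations.FramedGaloisRep K (PadicAlgCl 2) n), ρ.toGaloisRep.IsIrreducible → (∀ τ : Field.absoluteGaloisGroup K →* GL (Fin n) (Literature.NumberTheory.GaloisRepresentations.padicAlgClResidueField 2), ρ.IsResidualRepOf (RingHom.id (Literature.NumberTheory.GaloisRepresentations.padicAlgClResidueField 2)) τ → ¬ IsSolvable τ.range) → ((∀ᶠ v : IsDedekindDomain.HeightOneSpectrum (NumberField.RingOfIntegers K) in cofinite, ρ.IsUnramifiedAt v) ∧ ∀ (v : IsDedekindDomain.HeightOneSpectrum (NumberField.RingOfIntegers K)) (hv : ((2 :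 ℕ) : NumberField.RingOfIntegers K) ∈ v.asIdeal), (Literature.NumberTheory.PAdicHodge.fontainePstAdicCompletion v 2 hv).IsDeRhamFramed (ρ.toLocal v)) → (∀ v : IsDedekindDomain.HeightOneSpectrum (NumberField.RingOfIntegers K), ((2 : ℕ) : NumberField.RingOfIntegers K) ∉ v.asIdeal → ρ.IsUnramifiedAt v) → ∃ π : Literature.NumberTheory.Automorphic.CuspidalAutomorphicRepData n K hcpt, π.1.IsLAlgebraic ∧ ∀ᶠ v : IsDedekindDomain.HeightOneSpectrum (NumberField.RingOfIntegers K) in cofinite, ρ.IsUnramifiedAt v ∧ (∃ α : Multiset ℂ, π.1.HasSatakeParamAt v α) ∧ ∀ α : Multiset ℂ, π.1.HasSatakeParamAt v α → ∃ P Q : Polynomial (Valued.v : Valuation (PadicAlgCl 2) NNReal).valuationSubring, ρ.HasFrobCharpolyAt v (P.map (Valued.v : Valuation (PadicAlgCl 2) NNReal).valuationSubring.subtype) ∧ Literature.NumberTheory.Automorphic.arithFrobPolyOfSatake ι v.residueCard 1 α = Q.map (Valued.v : Valuation (PadicAlgCl 2) NNReal).valuationSubring.subtype ∧ P.map (IsLocalRing.residue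 (Valued.v : Valuation (PadicAlgCl 2) NNReal).valuationSubring) = Q.map (IsLocalRing.residue (Valued.v : Valuation (PadicAlgCl 2) NNReal).valuationSubring)

/-- [support FRAME · content = the host route-Langlands-MinimalLevelDescent rev 3 VERBATIM below B₂: `B₂ → Langlands`, i.e. its six
other deciding binders D `LevelPrimeDescent`, Lift_w `AutomorphyLifting`, W⁺ `SatakeAvatarExistence`, P `PadicMemberCompatibility`,
L∤R `CompatibilityAwayFromLR`, CRD `CanonicalReciprocityData` through `MinimalLevelDescent.closes` (certified `frame_of_host`);
Langlands ⟹ FRAME trivially (`frame_of_langlands`). Same device as PrimitiveCompanionReduction.LieIrreducibleCompanionFrame 33720.] -/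
def DyadicLevelOneFrame : Prop := Summit.Langlands.Langlands.Theses.MinimalLevelDescent.DyadicLevelOneAutomorphy → _root_.Langlands

/-! ## Bridges — every filed text is the vocabulary form, definitionally (`Iff.rfl`) -/

/-- B₂ in vocabulary form. -/
theorem dyadicLevelOneAutomorphy_iff : MinimalLevelDescent.DyadicLevelOneAutomorphy ↔
    ∀ (K : Type) [Field K] [NumberField K] (n : ℕ) (hcpt : isCompact_glFiniteIntegralLevel n K), 0 < n →
      ∀ (ι : PadicAlgCl 2 ≃+* ℂ) (ρ : FramedGaloisRep K (PadicAlgCl 2) n), ρ.toGaloisRep.IsIrreducible →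
        IsPinnedGeometric ρ → IsUnramifiedAwayFromTwo ρ → IsResiduallyAutomorphic hcpt ι ρ :=
  Iff.rfl

/-- AB in vocabulary form. -/
theorem abelianResidueAutomorphy_iff : AbelianResidueAutomorphy ↔
    ∀ (K : Type) [Field K] [NumberField K] (n : ℕ) (hcpt : isCompact_glFiniteIntegralLevel n K), 0 < n →
      ∀ (ι : PadicAlgCl 2 ≃+* ℂ) (ρ : FramedGaloisRep K (PadicAlgCl 2) n), ρ.toGaloisRep.IsIrreducible →
        IsResiduallyAbelian ρ → IsPinnedGeometric ρ → IsUnramifiedAwayFromTwo ρ → IsResiduallyAutomorphic hcpt ι ρ :=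
  Iff.rfl

/-- SOL in vocabulary form. -/
theorem solubleResidueAutomorphy_iff : SolubleResidueAutomorphy ↔
    ∀ (K : Type) [Field K] [NumberField K] (n : ℕ) (hcpt : isCompact_glFiniteIntegralLevel n K), 0 < n →
      ∀ (ι : PadicAlgCl 2 ≃+* ℂ) (ρ : FramedGaloisRep K (PadicAlgCl 2) n), ρ.toGaloisRep.IsIrreducible →
        IsResiduallySoluble ρ → ¬ IsResiduallyAbelian ρ → IsPinnedGeometric ρ → IsUnramifiedAwayFromTwo ρ →
          IsResiduallyAutomorphic hcpt ι ρ :=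
  Iff.rfl

/-- INS in vocabulary form. -/
theorem insolubleResidueAutomorphy_iff : InsolubleResidueAutomorphy ↔
    ∀ (K : Type) [Field K] [NumberField K] (n : ℕ) (hcpt : isCompact_glFiniteIntegralLevel n K), 0 < n →
      ∀ (ι : PadicAlgCl 2 ≃+* ℂ) (ρ : FramedGaloisRep K (PadicAlgCl 2) n), ρ.toGaloisRep.IsIrreducible →
        IsResiduallyInsoluble ρ → IsPinnedGeometric ρ → IsUnramifiedAwayFromTwo ρ → IsResiduallyAutomorphic hcpt ι ρ :=
  Iff.rfl

/-- FRAME is literally `B₂ → Langlands`. -/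
theorem dyadicLevelOneFrame_iff : DyadicLevelOneFrame ↔ (MinimalLevelDescent.DyadicLevelOneAutomorphy → _root_.Langlands) :=
  Iff.rfl

/-! ## Dial logic -/

omit [NumberField K] in
/-- INS-hypothesis ≡ ¬ SOL-hypothesis (the third cell is the complement of the first two; no junk enters the exactness). -/
theorem isResiduallyInsoluble_iff (ρ : FramedGaloisRep K (PadicAlgCl 2) n) :
    IsResiduallyInsoluble ρ ↔ ¬ IsResiduallySoluble ρ := by
  simp only [IsResiduallyInsoluble, IsResiduallySoluble, not_exists, not_and]

omit [NumberField K] in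
/-- An abelian residual image is soluble (so the three cells are: abelian | soluble non-abelian | insoluble). -/
theorem IsResiduallyAbelian.isResiduallySoluble {ρ : FramedGaloisRep K (PadicAlgCl 2) n} (h : IsResiduallyAbelian ρ) :
    IsResiduallySoluble ρ := by
  obtain ⟨τ, hτ, hcomm⟩ := h
  refine ⟨τ, hτ, isSolvable_of_comm fun a b => ?_⟩
  obtain ⟨a, ha⟩ := a
  obtain ⟨b, hb⟩ := b
  obtain ⟨g, rfl⟩ := MonoidHom.mem_range.mp ha
  obtain ⟨h, rfl⟩ := MonoidHom.mem_range.mp hb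
  exact Subtype.ext (hcomm g h)

omit [NumberField K] in
/-- The three cell dials are PAIRWISE DISJOINT and EXHAUSTIVE (a genuine partition of the ρ of B₂ by the solubility type of im ρ̄^ss):
cell AB reads `IsResiduallyAbelian ρ`, cell SOL reads `IsResiduallySoluble ρ ∧ ¬ IsResiduallyAbelian ρ`, cell INS reads `IsResiduallyInsoluble ρ`. -/
theorem dial_trichotomy (ρ : FramedGaloisRep K (PadicAlgCl 2) n) :
    IsResiduallyAbelian ρ ∨ (IsResiduallySoluble ρ ∧ ¬ IsResiduallyAbelian ρ) ∨ IsResiduallyInsoluble ρ := by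
  by_cases hab : IsResiduallyAbelian ρ
  · exact Or.inl hab
  · by_cases hsol : IsResiduallySoluble ρ
    · exact Or.inr (Or.inl ⟨hsol, hab⟩)
    · exact Or.inr (Or.inr ((isResiduallyInsoluble_iff ρ).mpr hsol))

omit [NumberField K] in
/-- The cells AB and SOL are disjoint: an abelian residual image is not «soluble non-abelian». -/
theorem dial_disjoint₁₂ (ρ : FramedGaloisRep K (PadicAlgCl 2) n) :
    ¬ (IsResiduallyAbelian ρ ∧ (IsResiduallySoluble ρ ∧ ¬ IsResiduallyAbelian ρ)) :=
  fun h => h.2.2 h.1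

omit [NumberField K] in
/-- The cells SOL and INS are disjoint: a soluble residual image is not insoluble (`isResiduallyInsoluble_iff`). -/
theorem dial_disjoint₂₃ (ρ : FramedGaloisRep K (PadicAlgCl 2) n) :
    ¬ ((IsResiduallySoluble ρ ∧ ¬ IsResiduallyAbelian ρ) ∧ IsResiduallyInsoluble ρ) :=
  fun h => (isResiduallyInsoluble_iff ρ).mp h.2 h.1.1

omit [NumberField K] in
/-- The cells AB and INS are disjoint: an abelian residual image is soluble, hence not insoluble. -/
theorem dial_disjoint₁₃ (ρ : FramedGaloisRep K (PadicAlgCl 2) n) :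
    ¬ (IsResiduallyAbelian ρ ∧ IsResiduallyInsoluble ρ) :=
  fun h => (isResiduallyInsoluble_iff ρ).mp h.2 h.1.isResiduallySoluble

/-! ## KERNEL I — exactness: B₂ ⟺ AB ∧ SOL ∧ INS (two excluded middles, pure logic) -/

/-- B₂ ⟹ AB (drop the dial hypothesis). -/
theorem abelian_of_dyadic (hB : MinimalLevelDescent.DyadicLevelOneAutomorphy) : AbelianResidueAutomorphy :=
  fun K _ _ n hcpt hn ι ρ hirr _ hgeo hlvl => hB K n hcpt hn ι ρ hirr hgeo hlvl

/-- B₂ ⟹ SOL. -/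
theorem soluble_of_dyadic (hB : MinimalLevelDescent.DyadicLevelOneAutomorphy) : SolubleResidueAutomorphy :=
  fun K _ _ n hcpt hn ι ρ hirr _ _ hgeo hlvl => hB K n hcpt hn ι ρ hirr hgeo hlvl

/-- B₂ ⟹ INS. -/
theorem insoluble_of_dyadic (hB : MinimalLevelDescent.DyadicLevelOneAutomorphy) : InsolubleResidueAutomorphy :=
  fun K _ _ n hcpt hn ι ρ hirr _ hgeo hlvl => hB K n hcpt hn ι ρ hirr hgeo hlvl

/-- AB ∧ SOL ∧ INS ⟹ B₂: given ρ, decide the solubility type of its residual image. -/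
theorem dyadic_of_cells (hAB : AbelianResidueAutomorphy) (hSOL : SolubleResidueAutomorphy) (hINS : InsolubleResidueAutomorphy) :
    MinimalLevelDescent.DyadicLevelOneAutomorphy := by
  rw [dyadicLevelOneAutomorphy_iff]
  intro K _ _ n hcpt hn ι ρ hirr hgeo hlvl
  by_cases hab : IsResiduallyAbelian ρ
  · exact (abelianResidueAutomorphy_iff.mp hAB) K n hcpt hn ι ρ hirr hab hgeo hlvl
  · by_cases hsol : IsResiduallySoluble ρ
    · exact (solubleResidueAutomorphy_iff.mp hSOL) K n hcpt hn ι ρ hirr hsol hab hgeo hlvl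
    · exact (insolubleResidueAutomorphy_iff.mp hINS) K n hcpt hn ι ρ hirr ((isResiduallyInsoluble_iff ρ).mpr hsol) hgeo hlvl

/-- THE EXACT DECOMPOSITION of the node: B₂ ⟺ AB ∧ SOL ∧ INS. -/
theorem dyadicLevelOneAutomorphy_iff_cells :
    MinimalLevelDescent.DyadicLevelOneAutomorphy ↔
      (AbelianResidueAutomorphy ∧ SolubleResidueAutomorphy ∧ InsolubleResidueAutomorphy) :=
  ⟨fun hB => ⟨abelian_of_dyadic hB, soluble_of_dyadic hB, insoluble_of_dyadic hB⟩, fun h => dyadic_of_cells h.1 h.2.1 h.2.2⟩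

/-! ## KERNEL II — necessity from the summit: Langlands ⟹ Serre_w ⟹ B₂ ⟹ each cell; the frame -/

/-- Serre_w ⟹ B₂ (the corner (0, 2) of the height). -/
theorem dyadic_of_serre (hS : ResidualSplit.ResidualAutomorphy) : MinimalLevelDescent.DyadicLevelOneAutomorphy :=
  fun K _ _ n hcpt hn ι ρ hirr hgeo _ => hS K n hcpt hn 2 ι ρ hirr hgeo

/-- NECESSITY: Langlands ⟹ B₂ (through the landed `LevelOneDyadic.residualAutomorphy_of_langlands`). [kernel certificate] -/
theorem dyadic_of_langlands (hLg : _root_.Langlands) : MinimalLevelDescent.DyadicLevelOneAutomorphy :=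
  dyadic_of_serre (residualAutomorphy_of_langlands hLg)

/-- NECESSITY: Langlands ⟹ AB. [kernel certificate] -/
theorem abelian_of_langlands (hLg : _root_.Langlands) : AbelianResidueAutomorphy :=
  abelian_of_dyadic (dyadic_of_langlands hLg)

/-- NECESSITY: Langlands ⟹ SOL. [kernel certificate] -/
theorem soluble_of_langlands (hLg : _root_.Langlands) : SolubleResidueAutomorphy :=
  soluble_of_dyadic (dyadic_of_langlands hLg)

/-- NECESSITY: Langlands ⟹ INS. [kernel certificate] -/
theorem insoluble_of_langlands (hLg : _root_.Langlands) : InsolubleResidueAutomorphy :=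
  insoluble_of_dyadic (dyadic_of_langlands hLg)

/-- FRAME from the host route's six other deciding binders (content certificate: FRAME = route-Langlands-MinimalLevelDescent below B₂). -/
theorem frame_of_host (hD : MinimalLevelDescent.LevelPrimeDescent) (hL : MinimalLevelDescent.AutomorphyLifting)
    (hW : MinimalLevelDescent.SatakeAvatarExistence) (hP : MinimalLevelDescent.PadicMemberCompatibility)
    (hA : MinimalLevelDescent.CompatibilityAwayFromLR) (hR : MinimalLevelDescent.CanonicalReciprocityData) : DyadicLevelOneFrame :=
  fun hB => MinimalLevelDescent.closes hD hB hL hW hP hA hR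

/-- NECESSITY: Langlands ⟹ FRAME (trivially: a consequence of S used toward S). -/
theorem frame_of_langlands (hLg : _root_.Langlands) : DyadicLevelOneFrame := fun _ => hLg

/-! ## KERNEL III — residual automorphy is an invariant of the residual representation (any prime ℓ)

If ρ and ρ₀ : Γ_K → GL_n(ℚ̄_ℓ) have a COMMON semisimple residual representation τ and ρ₀ is residually automorphic (π cuspidal
L-algebraic, Satake ≡ Frobenius(ρ₀) mod 𝔪 at almost all places), then so is ρ, with the same π: at an unramified place the
ℓ-integral Frobenius polynomial of ρ (resp. ρ₀) reduces to det(X − τ(Frob)) (`IsResidualRepOf.hasResidualCharpolys`, uniqueness of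
the integral polynomial), so the two reductions agree.  This is the formal content of «B₂ depends on ρ only through τ». -/

/-- KERNEL III. -/
theorem isResiduallyAutomorphic_of_sharedResidual {hcpt : isCompact_glFiniteIntegralLevel n K} {ι : PadicAlgCl ℓ ≃+* ℂ}
    {ρ ρ₀ : FramedGaloisRep K (PadicAlgCl ℓ) n} {τ : Field.absoluteGaloisGroup K →* GL (Fin n) (padicAlgClResidueField ℓ)}
    (hρ : ρ.IsResidualRepOf (RingHom.id _) τ) (hρ₀ : ρ₀.IsResidualRepOf (RingHom.id _) τ)
    (hur : ∀ᶠ v : HeightOneSpectrum (𝓞 K) in cofinite, ρ.IsUnramifiedAt v)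
    (h₀ : IsResiduallyAutomorphic hcpt ι ρ₀) : IsResiduallyAutomorphic hcpt ι ρ := by
  obtain ⟨π, hLπ, hπ⟩ := h₀
  refine ⟨π, hLπ, ?_⟩
  filter_upwards [hur, hπ] with v hv ⟨hv₀, hα, hall⟩
  refine ⟨hv, hα, fun α hαv => ?_⟩
  obtain ⟨P₀, Q, hP₀, hQ, hPQ⟩ := hall α hαv
  -- a prime of K̄ above v and an arithmetic Frobenius there
  obtain ⟨𝔓, h𝔓⟩ := v.primesAbove_nonempty
  obtain ⟨g, hg⟩ := HeightOneSpectrum.exists_isArithFrobAt_of_mem_primesAbove_holds h𝔓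
  -- the integral polynomials of ρ g and ρ₀ g reducing to det(X − τ g)
  obtain ⟨P, hP, hPτ⟩ := hρ.hasResidualCharpolys g
  obtain ⟨P₁, hP₁, hP₁τ⟩ := hρ₀.hasResidualCharpolys g
  -- ρ is unramified at v, so P is its Frobenius polynomial at v
  have hPρ : ρ.HasFrobCharpolyAt v (P.map (padicAlgClIntegers ℓ).subtype) := by
    have h := hv.hasFrobCharpolyAt_charpoly h𝔓 hg
    have e : FramedRep.charpoly ρ g = P.map (padicAlgClIntegers ℓ).subtype := hP.symm
    rw [e] at h
    exact h
  -- ρ₀'s Frobenius polynomial P₀ at v is the integral polynomial P₁ of ρ₀ g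
  have hP₀₁ : P₀ = P₁ := by
    apply Polynomial.map_injective (padicAlgClIntegers ℓ).subtype Subtype.val_injective
    have e := hP₀ 𝔓 h𝔓 g hg
    rw [hP₁, ← e]
    rfl
  refine ⟨P, Q, hPρ, hQ, ?_⟩
  rw [← hPQ, hP₀₁]
  rw [RingHom.id_comp] at hPτ hP₁τ
  exact hPτ.trans hP₁τ.symm

/-! ## KERNEL IV — the certified reductions of the two attackable cells (their BC3 birth skeletons' compositions) and INS by rank

The four line lemmas are HYPOTHESES here (stubs `stub_*` of the kit's skeleton files, texts verbatim):
* TL `stub_teichmullerLift` (folklore: characters lift by Teichmüller) / FS `stub_fongSwanLift` (Fong–Swan: a soluble τ is the reduction of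
  a finite-soluble-image Artin representation ρ₀, of level one because ker τ ⊇ the inertia at v ∤ 2 killed by ρ);
* EC `stub_eisensteinCuspidalisation` / SA `stub_solubleArtinResidualAutomorphy`: residual automorphy mod 2 of finite-abelian-image /
  finite-soluble-image level-one Artin representations (Eisenstein cuspidalisation mod 2; solvable strong Artin + cuspidalisation). -/

/-- AB ⟸ TL ∧ EC (through KERNEL III). -/
theorem abelianResidueAutomorphy_of_line
    (hTL : ∀ (K : Type) [Field K] [NumberField K] (n : ℕ) (ρ : Literature.NumberTheory.GaloisRepresentations.FramedGaloisRep K (PadicAlgCl 2) n) (τ : Field.absoluteGaloisGroup K →* GL (Fin n) (Literature.NumberTheory.GaloisRepresentations.padicAlgClResidueField 2)), ρ.IsResidualRepOf (RingHom.id (Literature.NumberTheory.GaloisRepresentations.padicAlgClResidueField 2)) τ → (∀ g h : Field.absoluteGaloisGroup K, τ g * τ h = τ h * τ g) → (∀ᶠ v : IsDedekindDomain.HeightOneSpectrum (NumberField.RingOfIntegers K) in cofinite, ρ.IsUnramifiedAt v) → (∀ v : IsDedekindDomain.HeightOneSpectrum (NumberField.RingOfIntegers K), ((2 : ℕ) :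 NumberField.RingOfIntegers K) ∉ v.asIdeal → ρ.IsUnramifiedAt v) → ∃ ρ₀ : Literature.NumberTheory.GaloisRepresentations.FramedGaloisRep K (PadicAlgCl 2) n, (Set.range (fun g : Field.absoluteGaloisGroup K => ρ₀ g)).Finite ∧ (∀ g h : Field.absoluteGaloisGroup K, ρ₀ g * ρ₀ h = ρ₀ h * ρ₀ g) ∧ ρ₀.IsResidualRepOf (RingHom.id (Literature.NumberTheory.GaloisRepresentations.padicAlgClResidueField 2)) τ ∧ (∀ᶠ v : IsDedekindDomain.HeightOneSpectrum (NumberField.RingOfIntegers K) in cofinite, ρ₀.IsUnramifiedAt v) ∧ (∀ v : IsDedekindDomain.HeightOneSpectrum (NumberField.RingOfIntegers K), ((2 : ℕ) : NumberField.RingOfIntegers K) ∉ v.asIdeal → ρ₀.IsUnramifiedAt v))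
    (hEC : ∀ (K : Type) [Field K] [NumberField K] (n : ℕ) (hcpt : Literature.NumberTheory.Automorphic.isCompact_glFiniteIntegralLevel n K), 0 < n → ∀ (ι : PadicAlgCl 2 ≃+* ℂ) (ρ₀ : Literature.NumberTheory.GaloisRepresentations.FramedGaloisRep K (PadicAlgCl 2) n), (Set.range (fun g : Field.absoluteGaloisGroup K => ρ₀ g)).Finite → (∀ g h : Field.absoluteGaloisGroup K, ρ₀ g * ρ₀ h = ρ₀ h * ρ₀ g) → (∀ᶠ v : IsDedekindDomain.HeightOneSpectrum (NumberField.RingOfIntegers K) in cofinite, ρ₀.IsUnramifiedAt v) → (∀ v : IsDedekindDomain.HeightOneSpectrum (NumberField.RingOfIntegers K), ((2 : ℕ) : NumberField.RingOfIntegers K) ∉ v.asIdeal → ρ₀.IsUnramifiedAt v) → ∃ π : Literature.NumberTheory.Automorphic.CuspidalAutomorphicRepData n K hcpt, π.1.IsLAlgebraic ∧ ∀ᶠ v : IsDedekindDomain.HeightOneSpectrum (NumberField.RingOfIntegers K) in cofinite, ρ₀.IsUnramifiedAt v ∧ (∃ α : Multiset ℂ, π.1.HasSatakeParamAt v α) ∧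 ∀ α : Multiset ℂ, π.1.HasSatakeParamAt v α → ∃ P Q : Polynomial (Valued.v : Valuation (PadicAlgCl 2) NNReal).valuationSubring, ρ₀.HasFrobCharpolyAt v (P.map (Valued.v : Valuation (PadicAlgCl 2) NNReal).valuationSubring.subtype) ∧ Literature.NumberTheory.Automorphic.arithFrobPolyOfSatake ι v.residueCard 1 α = Q.map (Valued.v : Valuation (PadicAlgCl 2) NNReal).valuationSubring.subtype ∧ P.map (IsLocalRing.residue (Valued.v : Valuation (PadicAlgCl 2) NNReal).valuationSubring) = Q.map (IsLocalRing.residue (Valued.v : Valuation (PadicAlgCl 2) NNReal).valuationSubring)) :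
    AbelianResidueAutomorphy := by
  rw [abelianResidueAutomorphy_iff]
  intro K _ _ n hcpt hn ι ρ hirr hab hgeo hlvl
  obtain ⟨τ, hτ, hcomm⟩ := hab
  obtain ⟨ρ₀, hfin, hab₀, hτ₀, hur₀, hlvl₀⟩ := hTL K n ρ τ hτ hcomm hgeo.1 hlvl
  exact isResiduallyAutomorphic_of_sharedResidual hτ hτ₀ hgeo.1 (hEC K n hcpt hn ι ρ₀ hfin hab₀ hur₀ hlvl₀)

/-- SOL ⟸ FS ∧ SA (through KERNEL III): the soluble cell is a CHARACTERISTIC-0 Artin statement. -/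
theorem solubleResidueAutomorphy_of_line
    (hFS : ∀ (K : Type) [Field K] [NumberField K] (n : ℕ) (ρ : Literature.NumberTheory.GaloisRepresentations.FramedGaloisRep K (PadicAlgCl 2) n) (τ : Field.absoluteGaloisGroup K →* GL (Fin n) (Literature.NumberTheory.GaloisRepresentations.padicAlgClResidueField 2)), ρ.IsResidualRepOf (RingHom.id (Literature.NumberTheory.GaloisRepresentations.padicAlgClResidueField 2)) τ → IsSolvable τ.range → (∀ᶠ v : IsDedekindDomain.HeightOneSpectrum (NumberField.RingOfIntegers K) in cofinite, ρ.IsUnramifiedAt v) → (∀ v : IsDedekindDomain.HeightOneSpectrum (NumberField.RingOfIntegers K), ((2 : ℕ) : NumberField.RingOfIntegers K) ∉ v.asIdeal → ρ.IsUnramifiedAt v) → ∃ ρ₀ : Literature.NumberTheory.GaloisRepresentations.FramedGaloisRep K (PadicAlgCl 2) n, (Set.range (fun g : Field.absoluteGaloisGroup K => ρ₀ g)).Finite ∧ IsSolvable (MonoidHom.range (ρ₀ : Field.absoluteGaloisGroup K →* GL (Fin n) (PadicAlgCl 2))) ∧ ρ₀.IsResidualRepOf (RingHom.id (Literature.NumberTheory.GaloisRepresentations.padicAlgClResidueField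 2)) τ ∧ (∀ᶠ v : IsDedekindDomain.HeightOneSpectrum (NumberField.RingOfIntegers K) in cofinite, ρ₀.IsUnramifiedAt v) ∧ (∀ v : IsDedekindDomain.HeightOneSpectrum (NumberField.RingOfIntegers K), ((2 : ℕ) : NumberField.RingOfIntegers K) ∉ v.asIdeal → ρ₀.IsUnramifiedAt v))
    (hSA : ∀ (K : Type) [Field K] [NumberField K] (n : ℕ) (hcpt : Literature.NumberTheory.Automorphic.isCompact_glFiniteIntegralLevel n K), 0 < n → ∀ (ι : PadicAlgCl 2 ≃+* ℂ) (ρ₀ : Literature.NumberTheory.GaloisRepresentations.FramedGaloisRep K (PadicAlgCl 2) n), (Set.range (fun g : Field.absoluteGaloisGroup K => ρ₀ g)).Finite → IsSolvable (MonoidHom.range (ρ₀ : Field.absoluteGaloisGroup K →* GL (Fin n) (PadicAlgCl 2))) → (∀ᶠ v : IsDedekindDomain.HeightOneSpectrum (NumberField.RingOfIntegers K) in cofinite, ρ₀.IsUnramifiedAt v) → (∀ v : IsDedekindDomain.HeightOneSpectrum (NumberField.RingOfIntegers K), ((2 : ℕ) : NumberField.RingOfIntegers K) ∉ v.asIdeal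 → ρ₀.IsUnramifiedAt v) → ∃ π : Literature.NumberTheory.Automorphic.CuspidalAutomorphicRepData n K hcpt, π.1.IsLAlgebraic ∧ ∀ᶠ v : IsDedekindDomain.HeightOneSpectrum (NumberField.RingOfIntegers K) in cofinite, ρ₀.IsUnramifiedAt v ∧ (∃ α : Multiset ℂ, π.1.HasSatakeParamAt v α) ∧ ∀ α : Multiset ℂ, π.1.HasSatakeParamAt v α → ∃ P Q : Polynomial (Valued.v : Valuation (PadicAlgCl 2) NNReal).valuationSubring, ρ₀.HasFrobCharpolyAt v (P.map (Valued.v : Valuation (PadicAlgCl 2) NNReal).valuationSubring.subtype) ∧ Literature.NumberTheory.Automorphic.arithFrobPolyOfSatake ι v.residueCard 1 α = Q.map (Valued.v : Valuation (PadicAlgCl 2) NNReal).valuationSubring.subtype ∧ P.map (IsLocalRing.residue (Valued.v : Valuation (PadicAlgCl 2) NNReal).valuationSubring) = Q.map (IsLocalRing.residue (Valued.v : Valuation (PadicAlgCl 2) NNReal).valuationSubring)) :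
    SolubleResidueAutomorphy := by
  rw [solubleResidueAutomorphy_iff]
  intro K _ _ n hcpt hn ι ρ hirr hsol _ hgeo hlvl
  obtain ⟨τ, hτ, hsolv⟩ := hsol
  obtain ⟨ρ₀, hfin, hsol₀, hτ₀, hur₀, hlvl₀⟩ := hFS K n ρ τ hτ hsolv hgeo.1 hlvl
  exact isResiduallyAutomorphic_of_sharedResidual hτ hτ₀ hgeo.1 (hSA K n hcpt hn ι ρ₀ hfin hsol₀ hur₀ hlvl₀)

/-- INS ⟸ INS≤2 ∧ INS≥3 (birth skeleton of the residual: the rank-2 Khare–Wintenberger–Kisin sector and the dark ranks). -/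
theorem insolubleResidueAutomorphy_of_ranks
    (h2 : ∀ (K : Type) [Field K] [NumberField K] (n : ℕ) (hcpt : Literature.NumberTheory.Automorphic.isCompact_glFiniteIntegralLevel n K), 0 < n → ∀ (ι : PadicAlgCl 2 ≃+* ℂ) (ρ : Literature.NumberTheory.GaloisRepresentations.FramedGaloisRep K (PadicAlgCl 2) n), ρ.toGaloisRep.IsIrreducible → n ≤ 2 → (∀ τ : Field.absoluteGaloisGroup K →* GL (Fin n) (Literature.NumberTheory.GaloisRepresentations.padicAlgClResidueField 2), ρ.IsResidualRepOf (RingHom.id (Literature.NumberTheory.GaloisRepresentations.padicAlgClResidueField 2)) τ → ¬ IsSolvable τ.range) → ((∀ᶠ v : IsDedekindDomain.HeightOneSpectrum (NumberField.RingOfIntegers K) in cofinite, ρ.IsUnramifiedAt v) ∧ ∀ (v : IsDedekindDomain.HeightOneSpectrum (NumberField.RingOfIntegers K)) (hv : ((2 : ℕ) : NumberField.RingOfIntegers K) ∈ v.asIdeal), (Literature.NumberTheory.PAdicHodge.fontainePstAdicCompletion v 2 hv).IsDeRhamFramed (ρ.toLocal v)) → (∀ v : IsDedekindDomain.HeightOneSpectrum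 (NumberField.RingOfIntegers K), ((2 : ℕ) : NumberField.RingOfIntegers K) ∉ v.asIdeal → ρ.IsUnramifiedAt v) → ∃ π : Literature.NumberTheory.Automorphic.CuspidalAutomorphicRepData n K hcpt, π.1.IsLAlgebraic ∧ ∀ᶠ v : IsDedekindDomain.HeightOneSpectrum (NumberField.RingOfIntegers K) in cofinite, ρ.IsUnramifiedAt v ∧ (∃ α : Multiset ℂ, π.1.HasSatakeParamAt v α) ∧ ∀ α : Multiset ℂ, π.1.HasSatakeParamAt v α → ∃ P Q : Polynomial (Valued.v : Valuation (PadicAlgCl 2) NNReal).valuationSubring, ρ.HasFrobCharpolyAt v (P.map (Valued.v : Valuation (PadicAlgCl 2) NNReal).valuationSubring.subtype) ∧ Literature.NumberTheory.Automorphic.arithFrobPolyOfSatake ι v.residueCard 1 α = Q.map (Valued.v : Valuation (PadicAlgCl 2) NNReal).valuationSubring.subtype ∧ P.map (IsLocalRing.residue (Valued.v : Valuation (PadicAlgCl 2) NNReal).valuationSubring) = Q.map (IsLocalRing.residue (Valued.v : Valuation (PadicAlgCl 2) NNReal).valuationSubring))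
    (h3 : ∀ (K : Type) [Field K] [NumberField K] (n : ℕ) (hcpt : Literature.NumberTheory.Automorphic.isCompact_glFiniteIntegralLevel n K), 0 < n → ∀ (ι : PadicAlgCl 2 ≃+* ℂ) (ρ : Literature.NumberTheory.GaloisRepresentations.FramedGaloisRep K (PadicAlgCl 2) n), ρ.toGaloisRep.IsIrreducible → 3 ≤ n → (∀ τ : Field.absoluteGaloisGroup K →* GL (Fin n) (Literature.NumberTheory.GaloisRepresentations.padicAlgClResidueField 2), ρ.IsResidualRepOf (RingHom.id (Literature.NumberTheory.GaloisRepresentations.padicAlgClResidueField 2)) τ → ¬ IsSolvable τ.range) → ((∀ᶠ v : IsDedekindDomain.HeightOneSpectrum (NumberField.RingOfIntegers K) in cofinite, ρ.IsUnramifiedAt v) ∧ ∀ (v : IsDedekindDomain.HeightOneSpectrum (NumberField.RingOfIntegers K)) (hv : ((2 : ℕ) : NumberField.RingOfIntegers K) ∈ v.asIdeal), (Literature.NumberTheory.PAdicHodge.fontainePstAdicCompletion v 2 hv).IsDeRhamFramed (ρ.toLocal v)) → (∀ v : IsDedekindDomain.HeightOneSpectrum (NumberField.RingOfIntegers K), ((2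 : ℕ) : NumberField.RingOfIntegers K) ∉ v.asIdeal → ρ.IsUnramifiedAt v) → ∃ π : Literature.NumberTheory.Automorphic.CuspidalAutomorphicRepData n K hcpt, π.1.IsLAlgebraic ∧ ∀ᶠ v : IsDedekindDomain.HeightOneSpectrum (NumberField.RingOfIntegers K) in cofinite, ρ.IsUnramifiedAt v ∧ (∃ α : Multiset ℂ, π.1.HasSatakeParamAt v α) ∧ ∀ α : Multiset ℂ, π.1.HasSatakeParamAt v α → ∃ P Q : Polynomial (Valued.v : Valuation (PadicAlgCl 2) NNReal).valuationSubring, ρ.HasFrobCharpolyAt v (P.map (Valued.v : Valuation (PadicAlgCl 2) NNReal).valuationSubring.subtype) ∧ Literature.NumberTheory.Automorphic.arithFrobPolyOfSatake ι v.residueCard 1 α = Q.map (Valued.v : Valuation (PadicAlgCl 2) NNReal).valuationSubring.subtype ∧ P.map (IsLocalRing.residue (Valued.v : Valuation (PadicAlgCl 2) NNReal).valuationSubring) = Q.map (IsLocalRing.residue (Valued.v : Valuation (PadicAlgCl 2) NNReal).valuationSubring)) :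
    InsolubleResidueAutomorphy := by
  intro K _ _ n hcpt hn ι ρ hirr hins hgeo hlvl
  by_cases hn2 : n ≤ 2
  · exact h2 K n hcpt hn ι ρ hirr hn2 hins hgeo hlvl
  · exact h3 K n hcpt hn ι ρ hirr (by omega) hins hgeo hlvl

/-! ## KERNEL V — the deciding theorems -/

/-- `closes` over the host route's binders: B₂ replaced by its three cells (nine binders; the child route files the framed form). -/
theorem closes (hAB : AbelianResidueAutomorphy) (hSOL : SolubleResidueAutomorphy) (hINS : InsolubleResidueAutomorphy)
    (hD : MinimalLevelDescent.LevelPrimeDescent) (hL : MinimalLevelDescent.AutomorphyLifting)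
    (hW : MinimalLevelDescent.SatakeAvatarExistence) (hP : MinimalLevelDescent.PadicMemberCompatibility)
    (hA : MinimalLevelDescent.CompatibilityAwayFromLR) (hR : MinimalLevelDescent.CanonicalReciprocityData) : _root_.Langlands :=
  MinimalLevelDescent.closes hD (dyadic_of_cells hAB hSOL hINS) hL hW hP hA hR

/-- `closes` of the child route `InsolubleResidueReduction` (four binders: AB → SOL → INS → FRAME → Langlands). -/
theorem closes_framed (hAB : AbelianResidueAutomorphy) (hSOL : SolubleResidueAutomorphy) (hINS : InsolubleResidueAutomorphy)
    (hF : DyadicLevelOneFrame) : _root_.Langlands :=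
  hF (dyadic_of_cells hAB hSOL hINS)

/-- The host route's aside rung 27525 (B₂ over ℚ in rank 2) lies in the cells too: it follows from AB ∧ SOL ∧ INS. -/
theorem rung_of_cells (hAB : AbelianResidueAutomorphy) (hSOL : SolubleResidueAutomorphy) (hINS : InsolubleResidueAutomorphy) :
    MinimalLevelDescent.DyadicLevelOneRankTwoQ :=
  fun hcpt ι ρ hirr hgeo hlvl => dyadic_of_cells hAB hSOL hINS ℚ 2 hcpt two_pos ι ρ hirr hgeo hlvl

end Summit.Langlands.Langlands.Theorems.LevelOneDyadic.Residue
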